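/-
Copyright (c) 2026.  Released under the Apache 2.0 license.
HONEST FRAMING (binding on every statement below): kernel-checked linear algebra / elementary number theory about
ONE STEP (Step 8, the measurement of Lemma 3.13) of a WITHDRAWN quantum algorithm — Chen, "Quantum Algorithms for
Lattice Problems", ePrint 2024/555, Step 9 retracted 2024-04-18.  Nothing here repairs the algorithm, breaks a
lattice problem, or is progress on any summit; it adjudicates a tolerance constant of a dead procedure.
-/
import Literature.Computability.Cryptography.ChenQuantumLWEThresholdBoxFrames
import Literature.Computability.Cryptography.ChenQuantumLWEThresholdCompositeFailure

/-!
# Chen (ePrint 2024/555), Step 8: the tolerance threshold of the measurement ceiling is EXACTLY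
# `1/(𝔭(Q)² + 1)` for EVERY admissible modulus `Q` (`𝔭(Q)` = the largest prime factor of `Q`)

(AG) of the autopsy packet.  (Z) `ChenQuantumLWEThresholdLargestPrime` proved the ceiling for `32·ε·𝔭(Q)² ≤ 1`,
(AD) `ChenQuantumLWEThresholdAllPrimes` the exact constant `1/(Q² + 1)` for prime `Q`, (AE)
`ChenQuantumLWEThresholdCompositeFailure` the failure at `1/(p² + 1)` for every prime `p ∣ Q`, and (AF)
`ChenQuantumLWEThresholdBoxFrames` the abstract coarse step (`MUBBoxFrames.sameOutcome₃`: box frames with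
box-level unbiasedness are outcome-constant below `1/(p² + 1)` once outcomes are constant on boxes).  This module
performs the class-specific instantiation and closes the composite question:

* Part I — the overlap law for slope differences that are UNIT MULTIPLES OF A DIVISOR: for `Q = G′H′` and `u` a
  unit mod `Q`, `‖⟨B^τ_{g; x, w}|B^τ_{g + G′u; x′, w′}⟩‖² = (ν/Qⁿ/H′)²` whenever `H′(x − x′) = 0`,
  `H′(w_τ − w′_τ) = 0` and `w = w′` off `τ` (`Shape.normSq_bKet_bKet_of_torsion`; (Z) `normSq_zKet_tKet` is
  `u = 1`, (AC) `normSq_bKet_bKet_of_isUnit` is `H′ = Q`).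
* Part II — arithmetic of the block: unit lifting below the least prime factor (`exists_unit_mul_eq_mul_sub`),
  injectivity of `m ↦ G′m (mod G′H′)` on `m < H′`.
* Part III — THE DIVISOR RECURSION (`Shape.blockConst_of_dvd`): on the single-coordinate slope block at `τ`
  (slopes `g + G′k`, points `(x₀ + G′m₁, w₀[τ ↦ w₀ τ + G′m₂])`), every `ε`-almost-sure measurement with
  `ε·(p² + 1) < 1` for all primes `p ∣ H′` (`Q = G′H′`) gives ALL block vectors the same almost-certain outcome —
  strong induction on `H′`, peeling `p = minFac H′ ≥ 3` (`Q` is odd): the induction hypothesis at `H₀ = H′/p` makes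
  outcomes constant on the `p²` boxes (of `H₀²` vectors each) of every coarse slope family, Part I makes the `p`
  coarse families a `MUBBoxFrames p (ν/Qⁿ)` (`Shape.blockFrames`), and (AF) `MUBBoxFrames.sameOutcome₃` steps up.
* Part IV — Chen's Step 8: `Shape.step8_povm_ceiling_composite` (ceiling for `ε·(p² + 1) < 1 ∀ p ∣ Q`, i.e.
  `ε < 1/(𝔭(Q)² + 1)`; `Shape.step8_povm_ceiling_largestPrime_exact`), and with (AE) the exact threshold for EVERY
  admissible `Q`: `Shape.step8_tolerance_threshold` (any outcome type: ceiling below, two-outcome separation at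
  `1/(p² + 1)` for every `p ∣ Q`) and `Shape.step8_povm_sameOutcome_iff_lt_largestPrime_threshold` (two-outcome
  measurements: same outcome for every `ε`-almost-sure `E` ⟺ `ε < 1/(𝔭(Q)² + 1)`).

WHAT THIS SETTLES (autopsy bookkeeping, not mathematics news): the tolerance constant of the Step-8 measurement
ceiling, studied in (Q) → (Z) → (AC) → (AD) → (AE) → (AF), is now known EXACTLY for every admissible parameter set of
the withdrawn algorithm: `1/(𝔭(Q)² + 1)`.  It depends only on the largest prime factor of `Q`.

References: [ChenQuantumLattice2024] Y. Chen, Quantum Algorithms for Lattice Problems, ePrint 2024/555 (withdrawn),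
§3.1 p. 22, eq. (35) p. 31, Lemma 3.13 pp. 32–34, §3.5.8 pp. 33–34; [NielsenChuang2010] M. Nielsen, I. Chuang,
Quantum Computation and Quantum Information, CUP 2010, §2.2.6 p. 90, Box 2.3 p. 87.
-/

open scoped BigOperators ComplexOrder MatrixOrder
open Matrix Finset

namespace Literature.Computability.Cryptography.Chen2024

/-! ## Part I.  The overlap law for unit multiples of a divisor slope -/

namespace Shape

variable (S : Shape)

/-- **Unit multiples of a slope see the same blocks:** for `u` a unit mod `Q`,
`‖⟨Z_{x,w}|u^τ_{(G′u); x′, w′}⟩‖ = ‖⟨Z_{x,w}|u^τ_{G′; x″, w′}⟩‖` with `x − x″ = (x − x′)·u⁻¹` — the contributing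
blocks `η_τ·G′u = x − x′` are the blocks `η_τ·G′ = (x − x′)u⁻¹`, and the phase prefactors have norm one.
[cite: ChenQuantumLattice2024, eq. (35) p. 31, §3.5.8 p. 34] -/
theorem norm_zKet_tKet_mul_unit (h : S.Admissible) (τ : Fin S.n) (G' : ℕ) {u : ZMod S.Q} (hu : IsUnit u)
    (x x' : ZMod S.Q) (w w' : Fin S.n → ZMod S.Q) :
    ‖star (S.zKet x w) ⬝ᵥ S.tKet τ (((G' : ZMod S.Q) * u).val) x' w'‖
      = ‖star (S.zKet x w) ⬝ᵥ S.tKet τ G' (x - (x - x') * (↑(hu.unit⁻¹) : ZMod S.Q)) w'‖ := by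
  have hψ : ∀ a : ZMod S.Q, ‖(ZMod.stdAddChar a : ℂ)‖ = 1 := fun a => by
    rw [ZMod.stdAddChar_apply, Circle.norm_coe]
  have hcast : (((((G' : ZMod S.Q) * u).val : ℕ)) : ZMod S.Q) = (G' : ZMod S.Q) * u :=
    ZMod.natCast_zmod_val _
  rw [S.star_zKet_dotProduct_tKet h, S.star_zKet_dotProduct_tKet h]
  have hsum : ∑ η : Fin S.n → ZMod S.Q, (if η τ * (((((G' : ZMod S.Q) * u).val : ℕ)) : ZMod S.Q) = x - x'
        then (ZMod.stdAddChar (∑ t, η t * (w - w') t) : ℂ) else 0)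
      = ∑ η : Fin S.n → ZMod S.Q, (if η τ * (G' : ZMod S.Q) = x - (x - (x - x') * ↑(hu.unit⁻¹))
        then (ZMod.stdAddChar (∑ t, η t * (w - w') t) : ℂ) else 0) := by
    refine Finset.sum_congr rfl fun η _ => ?_
    have hiff : η τ * (((((G' : ZMod S.Q) * u).val : ℕ)) : ZMod S.Q) = x - x'
        ↔ η τ * (G' : ZMod S.Q) = x - (x - (x - x') * ↑(hu.unit⁻¹)) := by
      rw [hcast, sub_sub_cancel]
      constructor
      · intro he
        rw [← he, mul_assoc, mul_assoc, IsUnit.mul_val_inv, mul_one]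
      · intro he
        calc η τ * ((G' : ZMod S.Q) * u) = η τ * (G' : ZMod S.Q) * u := (mul_assoc _ _ _).symm
          _ = (x - x') * ↑(hu.unit⁻¹) * u := by rw [he]
          _ = x - x' := by rw [mul_assoc, IsUnit.val_inv_mul, mul_one]
    by_cases hc : η τ * (((((G' : ZMod S.Q) * u).val : ℕ)) : ZMod S.Q) = x - x'
    · rw [if_pos hc, if_pos (hiff.1 hc)]
    · rw [if_neg hc, if_neg (fun h' => hc (hiff.2 h'))]
  rw [hsum]
  simp only [norm_mul, hψ]

/-- **The overlap formula for unit multiples of a divisor slope:** for `Q = G′H′` and `u` a unit mod `Q`,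
`‖⟨Z_{x,w}|u^τ_{(G′u); x′, w′}⟩‖² = (ν/Qⁿ/H′)²·[H′(x − x′) = 0 ∧ ∀ t, spike_τ(H′)_t·(w_t − w′_t) = 0]` — the same
law as for slope `G′` ((Z) `Shape.normSq_zKet_tKet`). [cite: ChenQuantumLattice2024, eq. (35) p. 31, §3.5.8 pp. 33–34] -/
theorem normSq_zKet_tKet_mul_unit (h : S.Admissible) {G' H' : ℕ} (hQ : (S.Q : ℕ) = G' * H') (τ : Fin S.n)
    {u : ZMod S.Q} (hu : IsUnit u) (x x' : ZMod S.Q) (w w' : Fin S.n → ZMod S.Q) :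
    ‖star (S.zKet x w) ⬝ᵥ S.tKet τ (((G' : ZMod S.Q) * u).val) x' w'‖ ^ 2
      = if (H' : ZMod S.Q) * (x - x') = 0 ∧ ∀ t, ((spike τ H' t : ℕ) : ZMod S.Q) * (w t - w' t) = 0
        then (S.frameNormSq / ((S.Q : ℕ) : ℝ) ^ S.n / H') ^ 2 else 0 := by
  rw [S.norm_zKet_tKet_mul_unit h τ G' hu, S.normSq_zKet_tKet h hQ τ]
  have hiff : (H' : ZMod S.Q) * (x - (x - (x - x') * ↑(hu.unit⁻¹))) = 0
      ↔ (H' : ZMod S.Q) * (x - x') = 0 := by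
    rw [sub_sub_cancel]
    constructor
    · intro h0
      have e : (H' : ZMod S.Q) * (x - x') = (H' : ZMod S.Q) * ((x - x') * ↑(hu.unit⁻¹)) * u := by
        rw [mul_assoc, mul_assoc, IsUnit.val_inv_mul, mul_one]
      rw [e, h0, zero_mul]
    · intro h0
      rw [← mul_assoc, h0, zero_mul]
  by_cases hc : (H' : ZMod S.Q) * (x - x') = 0 ∧ ∀ t, ((spike τ H' t : ℕ) : ZMod S.Q) * (w t - w' t) = 0
  · rw [if_pos hc, if_pos ⟨hiff.2 hc.1, hc.2⟩]
  · rw [if_neg hc, if_neg (fun h' => hc ⟨hiff.1 h'.1, h'.2⟩)]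

/-- **THE OVERLAP LAW ON A TORSION BLOCK:** for `Q = G′H′`, two slope families at `τ` whose slopes differ by
`G′·u`, `u` a unit mod `Q`, overlap with `‖⟨B^τ_{g; x, w}|B^τ_{g′; x′, w′}⟩‖² = (ν/Qⁿ/H′)²` on every pair of
points with `H′(x − x′) = 0`, `H′(w_τ − w′_τ) = 0` and `w = w′` off `τ` (re-slope by `g·e_τ` as in (AC)
`Shape.normSq_bKet_bKet_of_isUnit`, then `Shape.normSq_zKet_tKet_mul_unit`; the re-sloped tails differ at `τ` by
`2p₁g·(x − x′)`, killed by `H′`). [cite: ChenQuantumLattice2024, eq. (35) p. 31, §3.1 p. 22, §3.5.8 pp. 33–34] -/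
theorem normSq_bKet_bKet_of_torsion (h : S.Admissible) {G' H' : ℕ} (hQ : (S.Q : ℕ) = G' * H') (τ : Fin S.n)
    {g g' u : ZMod S.Q} (hu : IsUnit u) (hg : g' - g = (G' : ZMod S.Q) * u)
    {x x' : ZMod S.Q} {w w' : Fin S.n → ZMod S.Q} (hx : (H' : ZMod S.Q) * (x - x') = 0)
    (hτ : (H' : ZMod S.Q) * (w τ - w' τ) = 0) (hoff : ∀ t, t ≠ τ → w t = w' t) :
    ‖star (S.bKet τ g x w) ⬝ᵥ S.bKet τ g' x' w'‖ ^ 2 = (S.frameNormSq / ((S.Q : ℕ) : ℝ) ^ S.n / H') ^ 2 := by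
  set γ : Fin S.n → ZMod S.Q := Pi.single τ g with hγ
  have h' : (S.reslope γ).Admissible := S.reslope_admissible h γ
  set W : Fin S.n → ZMod S.Q := w - x • S.bbar + x • (S.reslope γ).bbar with hW
  set W' : Fin S.n → ZMod S.Q := w' - x' • S.bbar + x' • (S.reslope γ).bbar with hW'
  have hL : S.bKet τ g x w = (S.reslope γ).zKet x W := by
    unfold bKet
    exact S.uKet_eq_reslope_zKet γ x _
  have hR : S.bKet τ g' x' w' = (S.reslope γ).tKet τ (((G' : ZMod S.Q) * u).val) x' W' := by
    unfold bKet
    have e : (Pi.single τ g' : Fin S.n → ZMod S.Q)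
        = γ + Pi.single τ ((((((G' : ZMod S.Q) * u).val : ℕ)) : ZMod S.Q)) := by
      rw [ZMod.natCast_zmod_val, hγ, ← Pi.single_add, ← hg, add_sub_cancel]
    rw [e, ← S.uKet_reslope]
    show _ = (S.reslope γ).uKet _ x' (W' - x' • (S.reslope γ).bbar)
    rw [hW', add_sub_cancel_right]
  have key := (S.reslope γ).normSq_zKet_tKet_mul_unit h' hQ τ hu x x' W W'
  rw [hL, hR]
  refine key.trans ?_
  have hC : (H' : ZMod S.Q) * (x - x') = 0
      ∧ ∀ t, ((spike τ H' t : ℕ) : ZMod S.Q) * (W t - W' t) = 0 := by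
    refine ⟨hx, fun t => ?_⟩
    by_cases ht : t = τ
    · rw [ht, spike_self]
      have e1 : W τ - W' τ = (w τ - w' τ) + 2 * ((S.p₁ : ℕ) : ZMod S.Q) * g * (x - x') := by
        rw [hW, hW']
        simp only [Pi.add_apply, Pi.sub_apply, Pi.smul_apply, smul_eq_mul, S.bbar_reslope h γ τ, hγ,
          Pi.single_eq_same]
        ring
      rw [e1, mul_add, hτ, zero_add,
        show (H' : ZMod S.Q) * (2 * ((S.p₁ : ℕ) : ZMod S.Q) * g * (x - x'))
            = 2 * ((S.p₁ : ℕ) : ZMod S.Q) * g * ((H' : ZMod S.Q) * (x - x')) by ring,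
        hx, mul_zero]
    · have hγt : γ t = 0 := by rw [hγ, Pi.single_eq_of_ne ht]
      have hWt : W t = w t := by
        rw [hW, Pi.add_apply, Pi.sub_apply, Pi.smul_apply, Pi.smul_apply, smul_eq_mul, smul_eq_mul,
          S.bbar_reslope h γ t, hγt, mul_zero, add_zero, sub_add_cancel]
      have hW't : W' t = w' t := by
        rw [hW', Pi.add_apply, Pi.sub_apply, Pi.smul_apply, Pi.smul_apply, smul_eq_mul, smul_eq_mul,
          S.bbar_reslope h γ t, hγt, mul_zero, add_zero, sub_add_cancel]
      rw [spike_of_ne _ ht, Nat.cast_one, one_mul, hWt, hW't, sub_eq_zero]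
      exact hoff t ht
  exact if_pos hC

end Shape

/-! ## Part II.  Arithmetic of the block: unit lifting below the least prime factor, injectivity -/

section Arith

variable {Q : ℕ} [NeZero Q]

/-- If `H′ ∣ Q` and `y ≡ 0 (mod H′)` then `G′·y = 0` in `ℤ_Q` for `Q = G′H′`. [folklore] -/
theorem natCast_mul_eq_zero_of_cast_eq_zero {G' H' : ℕ} (hQ : Q = G' * H') (y : ZMod Q)
    (hy : (ZMod.castHom (⟨G', by rw [hQ, mul_comm]⟩ : H' ∣ Q) (ZMod H')) y = 0) :
    (G' : ZMod Q) * y = 0 := by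
  haveI : NeZero H' := ⟨fun h0 => NeZero.ne Q (by rw [hQ, h0, mul_zero])⟩
  rw [ZMod.castHom_apply, ZMod.cast_eq_val, ZMod.natCast_eq_zero_iff] at hy
  obtain ⟨t, ht⟩ := hy
  calc (G' : ZMod Q) * y = (G' : ZMod Q) * ((y.val : ℕ) : ZMod Q) := by rw [ZMod.natCast_zmod_val]
    _ = (((G' * H') * t : ℕ) : ZMod Q) := by rw [ht]; push_cast; ring
    _ = 0 := by rw [← hQ, Nat.cast_mul, ZMod.natCast_self, zero_mul]

/-- **Unit lifting below the least prime factor:** for `Q = G′H′` and `0 < m < minFac H′`, `m` is coprime to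
`H′`, hence the reduction of a unit `u` mod `Q` with `G′·m = G′·u` in `ℤ_Q` (`ZMod.unitsMap` is onto). [folklore] -/
theorem exists_unit_mul_eq {G' H' m : ℕ} (hQ : Q = G' * H') (hm0 : m ≠ 0) (hm : m < H'.minFac) :
    ∃ u : ZMod Q, IsUnit u ∧ (G' : ZMod Q) * (m : ZMod Q) = (G' : ZMod Q) * u := by
  have hcop : Nat.Coprime m H' := (Nat.coprime_of_lt_minFac hm0 hm).symm
  have hdvd : H' ∣ Q := ⟨G', by rw [hQ, mul_comm]⟩
  obtain ⟨U, hU⟩ := ZMod.unitsMap_surjective hdvd (ZMod.unitOfCoprime m hcop)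
  refine ⟨(U : ZMod Q), U.isUnit, ?_⟩
  have hval : (ZMod.castHom hdvd (ZMod H')) (U : ZMod Q) = (m : ZMod H') := by
    rw [ZMod.castHom_apply, ← ZMod.unitsMap_val hdvd U, hU, ZMod.coe_unitOfCoprime]
  have h0 : (ZMod.castHom hdvd (ZMod H')) ((U : ZMod Q) - m) = 0 := by
    rw [map_sub, hval, map_natCast, sub_self]
  have := natCast_mul_eq_zero_of_cast_eq_zero hQ _ h0
  rw [mul_sub, sub_eq_zero] at this
  exact this.symm

/-- The signed form: for distinct `c, c′ < minFac H′` there is a unit `u` mod `Q` with `G′c′ − G′c = G′u`. [folklore] -/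
theorem exists_unit_mul_eq_mul_sub {G' H' c c' : ℕ} (hQ : Q = G' * H') (hc : c < H'.minFac)
    (hc' : c' < H'.minFac) (hne : c ≠ c') :
    ∃ u : ZMod Q, IsUnit u ∧ (G' : ZMod Q) * (c' : ZMod Q) - (G' : ZMod Q) * (c : ZMod Q) = (G' : ZMod Q) * u := by
  rcases Nat.lt_or_gt_of_ne hne with hlt | hlt
  · obtain ⟨u, hu, e⟩ := exists_unit_mul_eq hQ (Nat.sub_ne_zero_of_lt hlt) (lt_of_le_of_lt (Nat.sub_le _ _) hc')
    refine ⟨u, hu, ?_⟩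
    rw [← e, Nat.cast_sub hlt.le, mul_sub]
  · obtain ⟨u, hu, e⟩ := exists_unit_mul_eq hQ (Nat.sub_ne_zero_of_lt hlt) (lt_of_le_of_lt (Nat.sub_le _ _) hc)
    refine ⟨-u, hu.neg, ?_⟩
    rw [mul_neg, ← e, Nat.cast_sub hlt.le, mul_sub, neg_sub]

/-- `m ↦ G′·m (mod G′H′)` is injective on `m < H′`. [folklore] -/
theorem natCast_mul_inj {G' H' m m' : ℕ} (hQ : Q = G' * H') (hm : m < H') (hm' : m' < H')
    (h : (G' : ZMod Q) * (m : ZMod Q) = (G' : ZMod Q) * (m' : ZMod Q)) : m = m' := by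
  have hG : 0 < G' := Nat.pos_of_ne_zero (fun h0 => NeZero.ne Q (by rw [hQ, h0, zero_mul]))
  wlog hle : m ≤ m' generalizing m m'
  · exact (this hm' hm h.symm (le_of_not_ge hle)).symm
  have h0 : (((G' * (m' - m) : ℕ)) : ZMod Q) = 0 := by
    rw [Nat.cast_mul, Nat.cast_sub hle, mul_sub, ← h, sub_self]
  rw [ZMod.natCast_eq_zero_iff, hQ] at h0
  have h1 : H' ∣ m' - m := Nat.dvd_of_mul_dvd_mul_left hG h0
  have h2 : m' - m = 0 := Nat.eq_zero_of_dvd_of_lt h1 (by omega)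
  omega

omit [NeZero Q] in
/-- `G′·m` only depends on `m mod H′` in `ℤ_{G′H′}`. [folklore] -/
theorem natCast_mul_mod {G' H' : ℕ} (hQ : Q = G' * H') (m : ℕ) :
    (G' : ZMod Q) * (m : ZMod Q) = (G' : ZMod Q) * ((m % H' : ℕ) : ZMod Q) := by
  conv_lhs => rw [← Nat.mod_add_div m H']
  rw [Nat.cast_add, mul_add, Nat.cast_mul,
    show (G' : ZMod Q) * ((H' : ZMod Q) * ((m / H' : ℕ) : ZMod Q)) = ((G' * H' : ℕ) : ZMod Q) * ((m / H' : ℕ) : ZMod Q)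
      by push_cast; ring,
    ← hQ, ZMod.natCast_self, zero_mul, add_zero]

omit [NeZero Q] in
/-- `H′·(G′·y) = 0` in `ℤ_{G′H′}`. [folklore] -/
theorem natCast_mul_natCast_mul_eq_zero {G' H' : ℕ} (hQ : Q = G' * H') (y : ZMod Q) :
    (H' : ZMod Q) * ((G' : ZMod Q) * y) = 0 := by
  rw [← mul_assoc, show (H' : ZMod Q) * (G' : ZMod Q) = ((G' * H' : ℕ) : ZMod Q) by push_cast; ring, ← hQ,
    ZMod.natCast_self, zero_mul]

/-- The least prime factor of a divisor `H′ > 1` of an odd number is a prime `≥ 3`. [folklore] -/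
theorem three_le_minFac_of_dvd_odd {Q' H' : ℕ} (hodd : Odd Q') (hdvd : H' ∣ Q') (hH : H' ≠ 1) :
    3 ≤ H'.minFac := by
  have hp : H'.minFac.Prime := Nat.minFac_prime hH
  have h2 : H'.minFac ≠ 2 := by
    intro h2
    have : 2 ∣ Q' := h2 ▸ dvd_trans (Nat.minFac_dvd H') hdvd
    exact (Nat.not_even_iff_odd.2 hodd) (even_iff_two_dvd.2 this)
  have := hp.two_le
  omega

end Arith

/-! ## Part III.  The divisor recursion on the single-coordinate slope block -/

namespace Shape

variable (S : Shape)

/-- **A vector of the `G′`-block at `τ` through `(g; x₀, w₀)`:** the class member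
`B^τ_{g + G′k; x₀ + G′m₁, w₀[τ ↦ w₀(τ) + G′m₂]}` — dummy slope `g + G′k` at `τ`, first coordinate and
`τ`-th tail coordinate moved inside their `G′`-cosets, tail fixed off `τ`.
[cite: ChenQuantumLattice2024, §3.1 p. 22, eq. (35) p. 31, §3.5.8 pp. 33–34] -/
noncomputable def blockVec (τ : Fin S.n) (G' : ℕ) (g x₀ : ZMod S.Q) (w₀ : Fin S.n → ZMod S.Q)
    (k m₁ m₂ : ℕ) : (Fin (S.n + 1) → ZMod S.M) → ℂ :=
  S.bKet τ (g + (G' : ZMod S.Q) * (k : ZMod S.Q)) (x₀ + (G' : ZMod S.Q) * (m₁ : ZMod S.Q))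
    (Function.update w₀ τ (w₀ τ + (G' : ZMod S.Q) * (m₂ : ZMod S.Q)))

/-- Block vectors are nonzero (norm² `ν/Qⁿ > 0`). [folklore] -/
theorem bKet_ne_zero (h : S.Admissible) (τ : Fin S.n) (g x : ZMod S.Q) (w : Fin S.n → ZMod S.Q) :
    S.bKet τ g x w ≠ 0 := by
  intro h0
  have e := S.star_bKet_dotProduct_bKet h τ g x x w w
  rw [if_pos ⟨rfl, rfl⟩, h0, star_zero, zero_dotProduct] at e
  have : (S.frameNormSq / ((S.Q : ℕ) : ℝ) ^ S.n : ℝ) = 0 := by exact_mod_cast e.symm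
  exact S.frameNormSq_div_pos.ne' this

/-- The indices of a block vector only matter modulo `H′` (`Q = G′H′`). [folklore] -/
theorem blockVec_mod {G' H' : ℕ} (hQ : (S.Q : ℕ) = G' * H') (τ : Fin S.n) (g x₀ : ZMod S.Q)
    (w₀ : Fin S.n → ZMod S.Q) (k m₁ m₂ : ℕ) :
    S.blockVec τ G' g x₀ w₀ k m₁ m₂ = S.blockVec τ G' g x₀ w₀ (k % H') (m₁ % H') (m₂ % H') := by
  unfold blockVec
  rw [← natCast_mul_mod hQ k, ← natCast_mul_mod hQ m₁, ← natCast_mul_mod hQ m₂]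

/-- **Descent to a sub-block:** the vector with indices `(c + p·k; i₁ + p·d₁, i₂ + p·d₂)` of the `G′`-block
through `(g; x₀, w₀)` is the vector with indices `(k; d₁, d₂)` of the `G′p`-block through
`(g + G′c; x₀ + G′i₁, w₀[τ ↦ w₀(τ) + G′i₂])`. [folklore] -/
theorem blockVec_descend (τ : Fin S.n) (G' p : ℕ) (g x₀ : ZMod S.Q) (w₀ : Fin S.n → ZMod S.Q)
    (c k i₁ d₁ i₂ d₂ : ℕ) :
    S.blockVec τ G' g x₀ w₀ (c + p * k) (i₁ + p * d₁) (i₂ + p * d₂)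
      = S.blockVec τ (G' * p) (g + (G' : ZMod S.Q) * (c : ZMod S.Q)) (x₀ + (G' : ZMod S.Q) * (i₁ : ZMod S.Q))
          (Function.update w₀ τ (w₀ τ + (G' : ZMod S.Q) * (i₂ : ZMod S.Q))) k d₁ d₂ := by
  unfold blockVec
  rw [Function.update_idem, Function.update_self]
  congr 1
  · push_cast; ring
  · push_cast; ring
  · congr 1
    push_cast; ring

/-- Descent of the representative slopes (`k = 0`). [folklore] -/
theorem blockVec_descend₀ (τ : Fin S.n) (G' p : ℕ) (g x₀ : ZMod S.Q) (w₀ : Fin S.n → ZMod S.Q)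
    (c i₁ d₁ i₂ d₂ : ℕ) :
    S.blockVec τ G' g x₀ w₀ c (i₁ + p * d₁) (i₂ + p * d₂)
      = S.blockVec τ (G' * p) (g + (G' : ZMod S.Q) * (c : ZMod S.Q)) (x₀ + (G' : ZMod S.Q) * (i₁ : ZMod S.Q))
          (Function.update w₀ τ (w₀ τ + (G' : ZMod S.Q) * (i₂ : ZMod S.Q))) 0 d₁ d₂ := by
  have e := S.blockVec_descend τ G' p g x₀ w₀ c 0 i₁ d₁ i₂ d₂
  rwa [mul_zero, add_zero] at e

/-- **The coarse slope families of a block are box frames** (`Q = G′H′`, `H′ = p·H₀`, `p ≤ minFac H′`):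
family `c < p` = slope `g + G′c`, box `i ∈ (Fin p)²`, position `d ∈ (Fin H₀)²`, vector = the block vector with
indices `(c; i₁ + p·d₁, i₂ + p·d₂)`; each family is orthogonal of norm² `ν/Qⁿ` ((AC) `star_bKet_dotProduct_bKet`
and injectivity of the indexing), and a vector of family `c′` has mass exactly `(ν/Qⁿ)²/p²` on every box of
family `c ≠ c′`: the slopes differ by `G′(c′ − c)` with `0 < |c′ − c| < p ≤ minFac H′`, a unit multiple of
`G′` mod `Q` (`exists_unit_mul_eq_mul_sub`), so by `normSq_bKet_bKet_of_torsion` each of the `H₀²` vectors of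
the box is seen with `(ν/Qⁿ/H′)²`. [cite: ChenQuantumLattice2024, eq. (35) p. 31, §3.5.8 pp. 33–34;
NielsenChuang2010, Box 2.3 p. 87] -/
theorem blockFrames (h : S.Admissible) (τ : Fin S.n) {G' H' p H₀ : ℕ} (hQ : (S.Q : ℕ) = G' * H')
    (hH : H' = p * H₀) (hp : 0 < p) (hpmin : p ≤ H'.minFac) (hH₀ : 0 < H₀) (g x₀ : ZMod S.Q)
    (w₀ : Fin S.n → ZMod S.Q) :
    MUBBoxFrames p (S.frameNormSq / ((S.Q : ℕ) : ℝ) ^ S.n)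
      (fun (c : Fin p) (i : Fin p × Fin p) (d : Fin H₀ × Fin H₀) =>
        S.blockVec τ G' g x₀ w₀ c ((i.1 : ℕ) + p * d.1) ((i.2 : ℕ) + p * d.2)) where
  apos := S.frameNormSq_div_pos
  ppos := hp
  cardI := Fintype.card_fin p
  cardB := by rw [Fintype.card_prod, Fintype.card_fin, sq]
  dpos := by rw [Fintype.card_prod, Fintype.card_fin]; exact Nat.mul_pos hH₀ hH₀
  orth := fun c i d i' d' => by
    unfold blockVec
    rw [S.star_bKet_dotProduct_bKet h]
    by_cases hid : i = i' ∧ d = d'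
    · obtain ⟨rfl, rfl⟩ := hid
      rw [if_pos ⟨rfl, rfl⟩, if_pos ⟨rfl, rfl⟩]
    · rw [if_neg hid, if_neg]
      rintro ⟨hx, hw⟩
      apply hid
      -- mixed radix: `j + p·e < p·H₀ = H′`, and `i + p·d` with `i < p` determines `(i, d)`
      have hb : ∀ (j : Fin p) (e : Fin H₀), (j : ℕ) + p * e < H' := fun j e => by
        rw [hH]
        calc (j : ℕ) + p * e < p + p * e := by have := j.isLt; omega
          _ = p * (e + 1) := by ring
          _ ≤ p * H₀ := Nat.mul_le_mul_left _ e.isLt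
      have mixedRadix_inj : ∀ {i i' d d' : ℕ}, i < p → i' < p → i + p * d = i' + p * d' →
          i = i' ∧ d = d' := by
        intro i i' d d' hi hi' e
        have h1 : (i + p * d) % p = i := by rw [Nat.add_mul_mod_self_left, Nat.mod_eq_of_lt hi]
        have h2 : (i' + p * d') % p = i' := by rw [Nat.add_mul_mod_self_left, Nat.mod_eq_of_lt hi']
        have hii : i = i' := by rw [← h1, e, h2]
        subst hii
        exact ⟨rfl, Nat.eq_of_mul_eq_mul_left hp (by omega)⟩
      have hm₁ := natCast_mul_inj hQ (hb i.1 d.1) (hb i'.1 d'.1) (add_left_cancel hx)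
      have hwτ := congrFun hw τ
      rw [Function.update_self, Function.update_self] at hwτ
      have hm₂ := natCast_mul_inj hQ (hb i.2 d.2) (hb i'.2 d'.2) (add_left_cancel hwτ)
      obtain ⟨h11, h12⟩ := mixedRadix_inj i.1.isLt i'.1.isLt hm₁
      obtain ⟨h21, h22⟩ := mixedRadix_inj i.2.isLt i'.2.isLt hm₂
      exact ⟨Prod.ext (Fin.ext h11) (Fin.ext h21), Prod.ext (Fin.ext h12) (Fin.ext h22)⟩
  mub := fun c c' hcc' i d i' => by
    have hcp : (c : ℕ) < H'.minFac := lt_of_lt_of_le c.isLt hpmin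
    have hcp' : (c' : ℕ) < H'.minFac := lt_of_lt_of_le c'.isLt hpmin
    obtain ⟨u, hu, hGu⟩ := exists_unit_mul_eq_mul_sub hQ hcp hcp' (fun e => hcc' (Fin.ext e))
    have hterm : ∀ d' : Fin H₀ × Fin H₀,
        ‖star (S.blockVec τ G' g x₀ w₀ c ((i.1 : ℕ) + p * d.1) ((i.2 : ℕ) + p * d.2))
            ⬝ᵥ S.blockVec τ G' g x₀ w₀ c' ((i'.1 : ℕ) + p * d'.1) ((i'.2 : ℕ) + p * d'.2)‖ ^ 2
          = (S.frameNormSq / ((S.Q : ℕ) : ℝ) ^ S.n / H') ^ 2 := by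
      intro d'
      unfold blockVec
      refine S.normSq_bKet_bKet_of_torsion h hQ τ hu ?_ ?_ ?_ ?_
      · rw [add_sub_add_left_eq_sub, hGu]
      · rw [add_sub_add_left_eq_sub, ← mul_sub]
        exact natCast_mul_natCast_mul_eq_zero hQ _
      · rw [Function.update_self, Function.update_self, add_sub_add_left_eq_sub, ← mul_sub]
        exact natCast_mul_natCast_mul_eq_zero hQ _
      · intro t ht
        rw [Function.update_of_ne ht, Function.update_of_ne ht]
    simp_rw [hterm]
    rw [Finset.sum_const, Finset.card_univ, Fintype.card_prod, Fintype.card_fin, nsmul_eq_mul]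
    have hp0 : (p : ℝ) ≠ 0 := by exact_mod_cast hp.ne'
    have hH0 : (H₀ : ℝ) ≠ 0 := by exact_mod_cast hH₀.ne'
    rw [hH]
    push_cast
    field_simp

/-- **OUTCOME CONSTANCY ON THE `G′`-BLOCKS OF LEVEL `H′`** (`Q = G′H′`): every two vectors of the block at `τ`
through any `(g; x₀, w₀)` receive the same `ε`-almost-certain outcome.
[cite: ChenQuantumLattice2024, Lemma 3.13 pp. 32–34, §3.5.8 pp. 33–34] -/
def BlockConst (τ : Fin S.n) {κ : Type*} [Fintype κ] (E : POVM (Fin (S.n + 1) → ZMod S.M) κ) (ε : ℝ)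
    (H' : ℕ) : Prop :=
  ∀ G' : ℕ, (S.Q : ℕ) = G' * H' → ∀ (g x₀ : ZMod S.Q) (w₀ : Fin S.n → ZMod S.Q)
    (k m₁ m₂ k' m₁' m₂' : ℕ) (o o' : κ),
    E.AlmostCertain ε (S.blockVec τ G' g x₀ w₀ k m₁ m₂) o →
      E.AlmostCertain ε (S.blockVec τ G' g x₀ w₀ k' m₁' m₂') o' → o = o'

/-- Level `H′ = 1`: the block is a single ray (`G′ = Q ≡ 0`), which has at most one `ε`-almost-certain outcome
for `ε < 1/2`. [cite: NielsenChuang2010, §2.2.6 p. 90] -/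
theorem blockConst_one (h : S.Admissible) (τ : Fin S.n) {κ : Type*} [Fintype κ] [DecidableEq κ]
    (E : POVM (Fin (S.n + 1) → ZMod S.M) κ) {ε : ℝ} (hε : ε < 1 / 2) : S.BlockConst τ E ε 1 := by
  intro G' hQ g x₀ w₀ k m₁ m₂ k' m₁' m₂' o o' ho ho'
  rw [S.blockVec_mod hQ] at ho ho'
  simp only [Nat.mod_one] at ho ho'
  exact E.almostCertain_unique hε (by unfold blockVec; exact S.bKet_ne_zero h τ _ _ _) ho ho'

/-- **THE INDUCTION STEP `H₀ → H′ = p·H₀`** (`3 ≤ p ≤ minFac H′`, `ε·(p² + 1) < 1`): outcome constancy on the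
`G′p`-blocks gives constancy on the BOXES of the coarse slope families of a `G′`-block (`blockVec_descend`);
the families form a `MUBBoxFrames p (ν/Qⁿ)` (`blockFrames`), so (AF) `MUBBoxFrames.sameOutcome₃` makes all box
representatives agree; every block vector is tied to a representative by the induction hypothesis again.
[cite: ChenQuantumLattice2024, Lemma 3.13 pp. 32–34, §3.5.8 pp. 33–34; NielsenChuang2010, §2.2.6 p. 90] -/
theorem blockConst_step (h : S.Admissible) (τ : Fin S.n) {κ : Type*} [Fintype κ] [DecidableEq κ]
    (E : POVM (Fin (S.n + 1) → ZMod S.M) κ) {ε : ℝ}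
    (hEall : ∀ (s x : ZMod S.Q) (w : Fin S.n → ZMod S.Q), ∃ o, E.AlmostCertain ε (S.bKet τ s x w) o)
    {H' p H₀ : ℕ} (hH : H' = p * H₀) (hp3 : 3 ≤ p) (hpmin : p ≤ H'.minFac)
    (hε : ε * ((p : ℝ) ^ 2 + 1) < 1) (ih : S.BlockConst τ E ε H₀) : S.BlockConst τ E ε H' := by
  intro G' hQ g x₀ w₀ k m₁ m₂ k' m₁' m₂' o o' ho ho'
  have hp0 : 0 < p := by omega
  have hH'0 : 0 < H' := Nat.pos_of_ne_zero fun h0 => S.Q.ne_zero (by rw [hQ, h0, mul_zero])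
  have hH₀ : 0 < H₀ := Nat.pos_of_ne_zero fun h0 => hH'0.ne' (by rw [hH, h0, mul_zero])
  have hQ₀ : (S.Q : ℕ) = G' * p * H₀ := by rw [hQ, hH, mul_assoc]
  have hF := S.blockFrames h τ hQ hH hp0 hpmin hH₀ g x₀ w₀
  have hEv : ∀ (G'' : ℕ) (gg xx : ZMod S.Q) (ww : Fin S.n → ZMod S.Q) (kk mm₁ mm₂ : ℕ),
      ∃ o, E.AlmostCertain ε (S.blockVec τ G'' gg xx ww kk mm₁ mm₂) o :=
    fun _ _ _ _ _ _ _ => hEall _ _ _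
  -- outcomes are constant on boxes: the induction hypothesis on the `G′p`-sub-blocks
  have hbox : ∀ (c : Fin p) (i : Fin p × Fin p), ∃ oo, ∀ d : Fin H₀ × Fin H₀,
      E.AlmostCertain ε (S.blockVec τ G' g x₀ w₀ c ((i.1 : ℕ) + p * d.1) ((i.2 : ℕ) + p * d.2)) oo := by
    intro c i
    obtain ⟨oo, hoo⟩ := hEv (G' * p) (g + (G' : ZMod S.Q) * ((c : ℕ) : ZMod S.Q))
      (x₀ + (G' : ZMod S.Q) * (((i.1 : ℕ) : ℕ) : ZMod S.Q))
      (Function.update w₀ τ (w₀ τ + (G' : ZMod S.Q) * (((i.2 : ℕ) : ℕ) : ZMod S.Q))) 0 0 0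
    refine ⟨oo, fun d => ?_⟩
    obtain ⟨od, hod⟩ := hEv G' g x₀ w₀ c ((i.1 : ℕ) + p * d.1) ((i.2 : ℕ) + p * d.2)
    have e := S.blockVec_descend₀ τ G' p g x₀ w₀ c i.1 d.1 i.2 d.2
    rw [e] at hod ⊢
    rw [← ih (G' * p) hQ₀ _ _ _ 0 d.1 d.2 0 0 0 od oo hod hoo]
    exact hod
  -- every block vector is tied to a box of representatives
  have hred : ∀ (kk mm₁ mm₂ : ℕ) (o₁ : κ), E.AlmostCertain ε (S.blockVec τ G' g x₀ w₀ kk mm₁ mm₂) o₁ →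
      ∃ (c : Fin p) (i : Fin p × Fin p), ∀ oo, (∀ d : Fin H₀ × Fin H₀,
        E.AlmostCertain ε (S.blockVec τ G' g x₀ w₀ c ((i.1 : ℕ) + p * d.1) ((i.2 : ℕ) + p * d.2)) oo) →
          o₁ = oo := by
    intro kk mm₁ mm₂ o₁ ho₁
    rw [S.blockVec_mod hQ] at ho₁
    have hn₁ : mm₁ % H' < p * H₀ := by rw [← hH]; exact Nat.mod_lt _ hH'0
    have hn₂ : mm₂ % H' < p * H₀ := by rw [← hH]; exact Nat.mod_lt _ hH'0
    refine ⟨⟨kk % H' % p, Nat.mod_lt _ hp0⟩,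
      (⟨mm₁ % H' % p, Nat.mod_lt _ hp0⟩, ⟨mm₂ % H' % p, Nat.mod_lt _ hp0⟩), fun oo hoo => ?_⟩
    have hd := hoo (⟨mm₁ % H' / p, Nat.div_lt_of_lt_mul hn₁⟩, ⟨mm₂ % H' / p, Nat.div_lt_of_lt_mul hn₂⟩)
    have e₁ : S.blockVec τ G' g x₀ w₀ (kk % H') (mm₁ % H') (mm₂ % H')
        = S.blockVec τ (G' * p) (g + (G' : ZMod S.Q) * ((kk % H' % p : ℕ) : ZMod S.Q))
            (x₀ + (G' : ZMod S.Q) * ((mm₁ % H' % p : ℕ) : ZMod S.Q))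
            (Function.update w₀ τ (w₀ τ + (G' : ZMod S.Q) * ((mm₂ % H' % p : ℕ) : ZMod S.Q)))
            (kk % H' / p) (mm₁ % H' / p) (mm₂ % H' / p) := by
      conv_lhs => rw [← Nat.mod_add_div (kk % H') p, ← Nat.mod_add_div (mm₁ % H') p,
        ← Nat.mod_add_div (mm₂ % H') p]
      exact S.blockVec_descend τ G' p g x₀ w₀ _ _ _ _ _ _
    rw [e₁] at ho₁
    rw [S.blockVec_descend₀] at hd
    exact ih (G' * p) hQ₀ _ _ _ _ _ _ 0 (mm₁ % H' / p) (mm₂ % H' / p) o₁ oo ho₁ hd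
  obtain ⟨c, i, hc⟩ := hred k m₁ m₂ o ho
  obtain ⟨c', i', hc'⟩ := hred k' m₁' m₂' o' ho'
  obtain ⟨oo, hoo⟩ := hbox c i
  obtain ⟨oo', hoo'⟩ := hbox c' i'
  rw [hc oo hoo, hc' oo' hoo']
  exact hF.sameOutcome₃ hp3 E hε hbox (hoo (⟨0, hH₀⟩, ⟨0, hH₀⟩)) (hoo' (⟨0, hH₀⟩, ⟨0, hH₀⟩))

/-- **THE DIVISOR RECURSION:** for every divisor `H′` of `Q`, if `ε < 1/2`, `ε·(p² + 1) < 1` for every prime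
`p ∣ H′`, and every slope-family member at `τ` has an `ε`-almost-certain outcome, then the `G′`-blocks of
level `H′` are outcome-constant — strong induction on `H′`, peeling the least prime factor (`blockConst_step`,
`p = minFac H′ ≥ 3` because `Q` is odd). [cite: ChenQuantumLattice2024, Lemma 3.13 pp. 32–34, §3.5.8 pp. 33–34] -/
theorem blockConst_of_dvd (h : S.Admissible) (τ : Fin S.n) {κ : Type*} [Fintype κ] [DecidableEq κ]
    (E : POVM (Fin (S.n + 1) → ZMod S.M) κ) {ε : ℝ} (hε2 : ε < 1 / 2)
    (hEall : ∀ (s x : ZMod S.Q) (w : Fin S.n → ZMod S.Q), ∃ o, E.AlmostCertain ε (S.bKet τ s x w) o) :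
    ∀ H' : ℕ, H' ∣ (S.Q : ℕ) → (∀ p : ℕ, p.Prime → p ∣ H' → ε * ((p : ℝ) ^ 2 + 1) < 1) →
      S.BlockConst τ E ε H' := by
  intro H'
  induction H' using Nat.strong_induction_on with
  | _ H' ih =>
    intro hdvd hεp
    by_cases h1 : H' = 1
    · subst h1
      exact S.blockConst_one h τ E hε2
    have hH'0 : H' ≠ 0 := fun h0 => S.Q.ne_zero (Nat.eq_zero_of_zero_dvd (h0 ▸ hdvd))
    have hpP : H'.minFac.Prime := Nat.minFac_prime h1
    obtain ⟨H₀, hH⟩ := Nat.minFac_dvd H'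
    have hp3 : 3 ≤ H'.minFac := three_le_minFac_of_dvd_odd h.odd_Q hdvd h1
    have hH₀0 : H₀ ≠ 0 := fun h0 => hH'0 (by rw [hH, h0, mul_zero])
    have hH₀lt : H₀ < H' := by
      have e : 2 * H₀ ≤ H'.minFac * H₀ := Nat.mul_le_mul_right _ hpP.two_le
      omega
    have hH₀H : H₀ ∣ H' := ⟨H'.minFac, by rw [mul_comm]; exact hH⟩
    have ih₀ := ih H₀ hH₀lt (dvd_trans hH₀H hdvd) (fun q hq hqH => hεp q hq (dvd_trans hqH hH₀H))
    exact S.blockConst_step h τ E hEall hH hp3 le_rfl (hεp _ hpP (Nat.minFac_dvd H')) ih₀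

end Shape

/-! ## Part IV.  Chen's Step 8: the threshold `1/(𝔭(Q)² + 1)` for every admissible `Q` -/

namespace Shape

variable (S : Shape)

/-- **THE STEP-8 MEASUREMENT CEILING FOR EVERY ADMISSIBLE `Q` AT THE OPTIMAL CONSTANT.**  If a measurement of
the Step-8 register is `ε`-almost sure on the Karst-wave class `InClass U` of `S` with at least one unknown
tail coordinate (`t₁+1 ∈ U`) and `ε·(p² + 1) < 1` for every prime `p ∣ Q` — i.e. `ε < 1/(𝔭(Q)² + 1)`, `𝔭(Q)`
the largest prime factor — then `|φ7.d⟩` of `S` and of the shifted instance `(b, v′ + 2D²p₁b)` (different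
Step-9 requirements) get THE SAME almost-certain outcome: both are vectors of the `1`-block of level `Q` at
`t₁` (slope `0`, first coordinates `x₀`, `x₀ − 1`), outcome-constant by `blockConst_of_dvd`.  Supersedes
(Z) (`32·ε·𝔭(Q)² ≤ 1`), (AC)/(AD) (prime `Q`).  HONEST FRAMING: a theorem about the measurement step of a
WITHDRAWN algorithm (Chen, ePrint 2024/555) — it repairs nothing, breaks nothing, and is not progress on
any lattice problem. [cite: ChenQuantumLattice2024, Lemma 3.13 pp. 32–34, eq. (35) p. 31, §3.5.8 pp. 33–34;
NielsenChuang2010, §2.2.6 p. 90, Box 2.3 p. 87] -/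
theorem step8_povm_ceiling_composite (h : S.Admissible) {κ : Type*} [Fintype κ] [DecidableEq κ]
    (U : Finset (Fin (S.n + 1))) (t₁ : Fin S.n) (ht₁ : t₁.succ ∈ U)
    (E : POVM (Fin (S.n + 1) → ZMod S.M) κ) {ε : ℝ}
    (hε : ∀ p ∈ (S.Q : ℕ).primeFactors, ε * ((p : ℝ) ^ 2 + 1) < 1) (hE : S.AlmostSureOn ε U E)
    {k k' : κ} (hk : E.AlmostCertain ε S.phi7d k)
    (hk' : E.AlmostCertain ε (S.inst S.b (fun i => S.v' i + 2 * (S.D : ℤ) * S.D * S.p₁ * S.b i)).phi7d k') :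
    k = k' := by
  classical
  obtain ⟨c₀, x₀, y₀, hφS, hφS'⟩ : ∃ (c₀ : S.Coset) (x₀ : ZMod S.Q) (y₀ : Fin S.n → ZMod S.Q),
      S.phi7d = (S.cshape c₀).uKet 0 x₀ y₀
      ∧ (S.inst S.b (fun i => S.v' i + 2 * (S.D : ℤ) * S.D * S.p₁ * S.b i)).phi7d
          = (S.cshape c₀).uKet 0 (x₀ - 1) (fun t => y₀ t + ((S.b t.succ : ℤ) : ZMod S.Q)) :=
    ⟨_, _, _, S.phi7d_eq_uKet h, S.phi7d_shift_eq_uKet h⟩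
  have h₀ : (S.cshape c₀).Admissible := S.cshape_admissible h c₀
  have hE₀ : (S.cshape c₀).AlmostSureOn ε U E := fun b₂ v₂ hI => hE b₂ v₂ hI
  set w₀ : Fin S.n → ZMod S.Q := y₀ + x₀ • (S.cshape c₀).bbar with hw₀
  have hz₁ : (S.cshape c₀).zKet x₀ w₀ = S.phi7d := by
    rw [hφS, Shape.zKet, hw₀, add_sub_cancel_right]
  have hz₂ : (S.cshape c₀).zKet (x₀ - 1) w₀
      = (S.inst S.b (fun i => S.v' i + 2 * (S.D : ℤ) * S.D * S.p₁ * S.b i)).phi7d := by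
    rw [hφS', Shape.zKet, hw₀]
    congr 1
    funext t
    rw [Pi.sub_apply, Pi.add_apply, Pi.smul_apply, Pi.smul_apply, smul_eq_mul, smul_eq_mul,
      show (S.cshape c₀).bbar t = ((S.b t.succ : ℤ) : ZMod S.Q) from rfl]
    ring
  have hTU : ∀ t ∈ ({t₁} : Finset (Fin S.n)), t.succ ∈ U := fun t ht => by
    rw [Finset.mem_singleton.1 ht]; exact ht₁
  have hEz : ∀ (s x : ZMod S.Q) (w : Fin S.n → ZMod S.Q),
      ∃ k, E.AlmostCertain ε ((S.cshape c₀).bKet t₁ s x w) k := by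
    intro s x w
    unfold Shape.bKet
    exact (S.cshape c₀).exists_almostCertain_uKet h₀ hTU hE₀ _ _ _
      (fun t ht => by rw [Pi.single_eq_of_ne (fun h' => ht (Finset.mem_singleton.2 h'))])
  -- `ε < 1/2`: `Q` has a prime factor `p ≥ 2` with `ε·(p² + 1) < 1`
  have hQ1 : 1 < (S.Q : ℕ) := by have := h.three_le_Q; omega
  have hε2 : ε < 1 / 2 := by
    obtain ⟨p, hp⟩ := Nat.nonempty_primeFactors.2 hQ1
    have h2 : (2 : ℝ) ≤ p := by exact_mod_cast (Nat.prime_of_mem_primeFactors hp).two_le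
    have h1 := hε p hp
    nlinarith
  have hB := (S.cshape c₀).blockConst_of_dvd h₀ t₁ E hε2 hEz (S.Q : ℕ) dvd_rfl
    (fun p hp hpQ => hε p (Nat.mem_primeFactors.2 ⟨hp, hpQ, S.Q.ne_zero⟩))
  have e₁ : S.phi7d = (S.cshape c₀).blockVec t₁ 1 0 x₀ w₀ 0 0 0 := by
    unfold Shape.blockVec
    rw [Nat.cast_zero, Nat.cast_one, mul_zero, add_zero, add_zero, add_zero, Function.update_eq_self,
      ← Shape.zKet_eq_bKet, hz₁]
  have e₂ : (S.inst S.b (fun i => S.v' i + 2 * (S.D : ℤ) * S.D * S.p₁ * S.b i)).phi7d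
      = (S.cshape c₀).blockVec t₁ 1 0 x₀ w₀ 0 ((S.Q : ℕ) - 1) 0 := by
    unfold Shape.blockVec
    rw [Nat.cast_zero, Nat.cast_one, mul_zero, add_zero, add_zero, one_mul, Function.update_eq_self,
      Nat.cast_sub (S.Q.pos : 1 ≤ (S.Q : ℕ)), ZMod.natCast_self, Nat.cast_one, zero_sub, ← sub_eq_add_neg,
      ← Shape.zKet_eq_bKet, hz₂]
  rw [e₁] at hk
  rw [e₂] at hk'
  exact hB 1 (one_mul _).symm 0 x₀ w₀ 0 0 0 0 ((S.Q : ℕ) - 1) 0 k k' hk hk'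

/-- The ceiling below `1/(𝔭(Q)² + 1)`, `𝔭(Q) = max (primeFactors Q)`: `ε·(𝔭(Q)² + 1) < 1` implies
`ε·(p² + 1) < 1` for every prime `p ∣ Q`. HONEST FRAMING as above.
[cite: ChenQuantumLattice2024, Lemma 3.13 pp. 32–34, §3.5.8 pp. 33–34] -/
theorem step8_povm_ceiling_largestPrime_exact (h : S.Admissible) {κ : Type*} [Fintype κ] [DecidableEq κ]
    (U : Finset (Fin (S.n + 1))) (t₁ : Fin S.n) (ht₁ : t₁.succ ∈ U)
    (E : POVM (Fin (S.n + 1) → ZMod S.M) κ) {ε : ℝ} (hne : (S.Q : ℕ).primeFactors.Nonempty)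
    (hε : ε * ((((S.Q : ℕ).primeFactors.max' hne : ℕ) : ℝ) ^ 2 + 1) < 1) (hE : S.AlmostSureOn ε U E)
    {k k' : κ} (hk : E.AlmostCertain ε S.phi7d k)
    (hk' : E.AlmostCertain ε (S.inst S.b (fun i => S.v' i + 2 * (S.D : ℤ) * S.D * S.p₁ * S.b i)).phi7d k') :
    k = k' := by
  refine S.step8_povm_ceiling_composite h U t₁ ht₁ E (fun p hp => ?_) hE hk hk'
  have hle : (p : ℝ) ≤ ((S.Q : ℕ).primeFactors.max' hne : ℕ) := by
    exact_mod_cast Finset.le_max' _ p hp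
  have hp0 : (0 : ℝ) ≤ p := by exact_mod_cast (Nat.zero_le p)
  by_cases hε0 : ε ≤ 0
  · have : ε * ((p : ℝ) ^ 2 + 1) ≤ 0 := mul_nonpos_of_nonpos_of_nonneg hε0 (by positivity)
    linarith
  · push Not at hε0
    have hsq : (p : ℝ) ^ 2 + 1 ≤ (((S.Q : ℕ).primeFactors.max' hne : ℕ) : ℝ) ^ 2 + 1 := by nlinarith
    calc ε * ((p : ℝ) ^ 2 + 1) ≤ ε * ((((S.Q : ℕ).primeFactors.max' hne : ℕ) : ℝ) ^ 2 + 1) :=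
          mul_le_mul_of_nonneg_left hsq hε0.le
      _ < 1 := hε

/-- **THE EXACT STEP-8 TOLERANCE THRESHOLD FOR EVERY ADMISSIBLE MODULUS `Q`: `1/(𝔭(Q)² + 1)`.**  (i) Ceiling:
for `ε·(p² + 1) < 1` for all primes `p ∣ Q` (equivalently `ε < 1/(𝔭(Q)² + 1)`), every `ε`-almost-sure
measurement of any outcome type gives `S` and `(b, v′ + 2D²p₁b)` the same almost-certain outcome
(`step8_povm_ceiling_composite`); (ii) failure: for every prime `p ∣ Q` a two-outcome `1/(p² + 1)`-almost-sure
measurement separates them ((AE) `step8_povm_ceiling_fails_at_inv_prime_sq_succ`; at `p = 𝔭(Q)` this is the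
threshold).  This closes the composite question left open by (Z) (`Θ(1/𝔭(Q)²)`, window `[1/32, 1]·1/𝔭(Q)²`),
(AC)/(AD) (prime `Q`) and (AE) (window `[1/(32𝔭(Q)²), 1/(𝔭(Q)² + 1)]`).  Adjudication, not a claim of the
source; HONEST FRAMING: a kernel-checked constant about a WITHDRAWN algorithm's measurement step — not summit
progress. [cite: ChenQuantumLattice2024, Lemma 3.13 pp. 32–34, §3.5.8 pp. 33–34, §3.5.5 pp. 33–37;
NielsenChuang2010, §2.2.6 p. 90, Box 2.3 p. 87] -/
theorem step8_tolerance_threshold (h : S.Admissible) (U : Finset (Fin (S.n + 1))) :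
    (∀ {κ : Type} [Fintype κ] [DecidableEq κ] (t₁ : Fin S.n), t₁.succ ∈ U →
        ∀ (E : POVM (Fin (S.n + 1) → ZMod S.M) κ) {ε : ℝ},
          (∀ p ∈ (S.Q : ℕ).primeFactors, ε * ((p : ℝ) ^ 2 + 1) < 1) →
          S.AlmostSureOn ε U E →
            ∀ k k' : κ, E.AlmostCertain ε S.phi7d k →
              E.AlmostCertain ε (S.inst S.b (fun i => S.v' i + 2 * (S.D : ℤ) * S.D * S.p₁ * S.b i)).phi7d k'
                → k = k')
    ∧ ∀ p ∈ (S.Q : ℕ).primeFactors, ∃ (E : POVM (Fin (S.n + 1) → ZMod S.M) (Fin 2)) (k k' : Fin 2),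
        S.AlmostSureOn (1 / ((p : ℝ) ^ 2 + 1)) U E ∧ k ≠ k'
        ∧ E.AlmostCertain (1 / ((p : ℝ) ^ 2 + 1)) S.phi7d k
        ∧ E.AlmostCertain (1 / ((p : ℝ) ^ 2 + 1))
            (S.inst S.b (fun i => S.v' i + 2 * (S.D : ℤ) * S.D * S.p₁ * S.b i)).phi7d k' :=
  ⟨fun t₁ ht₁ E _ hε hE _ _ hk hk' => S.step8_povm_ceiling_composite h U t₁ ht₁ E hε hE hk hk',
    (S.step8_povm_ceiling_window h U).2⟩

/-- **The threshold as a number, every admissible `Q`:** for any class with an unknown tail coordinate, the set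
of tolerances `ε` at which EVERY `ε`-almost-sure two-outcome measurement gives `S` and `(b, v′ + 2D²p₁b)` the
same almost-certain outcome is exactly the half-line `ε < 1/(𝔭(Q)² + 1)`, `𝔭(Q)` the largest prime factor of
`Q` — (AD) `step8_povm_sameOutcome_iff_lt_threshold'` for composite `Q`.  Adjudication; HONEST FRAMING as above.
[cite: ChenQuantumLattice2024, Lemma 3.13 pp. 32–34, §3.5.8 pp. 33–34] -/
theorem step8_povm_sameOutcome_iff_lt_largestPrime_threshold (h : S.Admissible)
    (U : Finset (Fin (S.n + 1))) (t₁ : Fin S.n) (ht₁ : t₁.succ ∈ U) (ε : ℝ)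
    (hne : (S.Q : ℕ).primeFactors.Nonempty) :
    (∀ (E : POVM (Fin (S.n + 1) → ZMod S.M) (Fin 2)), S.AlmostSureOn ε U E →
        ∀ k k' : Fin 2, E.AlmostCertain ε S.phi7d k →
          E.AlmostCertain ε (S.inst S.b (fun i => S.v' i + 2 * (S.D : ℤ) * S.D * S.p₁ * S.b i)).phi7d k'
            → k = k')
      ↔ ε < 1 / ((((S.Q : ℕ).primeFactors.max' hne : ℕ) : ℝ) ^ 2 + 1) := by
  set P : ℕ := (S.Q : ℕ).primeFactors.max' hne with hP
  have hpos : (0 : ℝ) < (P : ℝ) ^ 2 + 1 := by positivity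
  constructor
  · intro H
    by_contra hge
    push Not at hge
    have hmem : P ∈ (S.Q : ℕ).primeFactors := Finset.max'_mem _ hne
    obtain ⟨E, k, k', hE, hkk, hk, hk'⟩ :=
      S.step8_povm_ceiling_fails_at_inv_prime_sq_succ h U (Nat.prime_of_mem_primeFactors hmem)
        (Nat.dvd_of_mem_primeFactors hmem)
    have mono : ∀ {φ : (Fin (S.n + 1) → ZMod S.M) → ℂ} {j : Fin 2},
        E.AlmostCertain (1 / ((P : ℝ) ^ 2 + 1)) φ j → E.AlmostCertain ε φ j := by
      intro φ j hj
      unfold POVM.AlmostCertain at hj ⊢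
      have hN := star_dotProduct_self_re_nonneg φ
      nlinarith
    exact hkk (H E (fun b₂ v₂ hI => (hE b₂ v₂ hI).imp fun j hj => mono hj) k k' (mono hk) (mono hk'))
  · intro hlt E hE k k' hk hk'
    have hε : ε * ((P : ℝ) ^ 2 + 1) < 1 := by rwa [lt_div_iff₀ hpos] at hlt
    exact S.step8_povm_ceiling_largestPrime_exact h U t₁ ht₁ E hne hε hE hk hk'

end Shape

end Literature.Computability.Cryptography.Chen2024
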